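import Summits.Ventures.HodgeRepro2.T5FinitePlaceLocalNorm

/-!
# `E_w` as a star-field at a non-split place: the local conjugation as `star`
(cell pub-hodge-repro2, seat p3)

Tier-5 N2 support, §N2.9.2 of route/T5-N2-route-3.md («completions») at the finite places, continued from files
115–118. The cell's Gram-matrix lemmas on «an arbitrary field `E` with a ring involution (`E_v` or the CM field)»
(file 100 T5GramScaling: `isSkewHermitian_smul`, `unitaryOfMat_smul`, `det_smul_odd`, … over `[StarRing E]`) need the
local field `E_w` of a non-split place `w ∣ v` as a STAR-FIELD with star = the local conjugation of file 117. This file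
packages that structure as a DEFINITION (`localStarRing : StarRing E_w`, never an instance — `adicCompletion E w` is
Mathlib's type), with: `star` on the image of `E` is `c` (`star_algebraMap`), `star` fixes `F_v`
(`star_algebraMap_left`, `isSelfAdjoint_algebraMap_left`), `star √θ = −√θ` (`star_algebraMap_s`), and
`y · star y = N_{E_w/F_v}(y)` (`mul_star_eq_norm`, file 118). The CM-type hypothesis `c s = −s` forces `c` to be an
involution (`trans_self_eq_refl_of_apply_s_eq_neg`). Mathlib + files 115–118 only.
No display; no device. §8(d): uses an L-value-free non-vanishing device: NO.
-/

namespace Summit.Ventures.HodgeRepro2.T5FinitePlaceStar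

open IsDedekindDomain IsDedekindDomain.HeightOneSpectrum NumberField Module
open scoped Summit.Ventures.HodgeRepro2.T5FinitePlaceLiesOver
open Summit.Ventures.HodgeRepro2.T5FinitePlaceLiesOver Summit.Ventures.HodgeRepro2.T5FinitePlaceQuadratic
  Summit.Ventures.HodgeRepro2.T5FinitePlaceTensorEquiv Summit.Ventures.HodgeRepro2.T5FinitePlaceLocalNorm

section Involution

variable {F E : Type*} [Field F] [Field E] [Algebra F E] {s : E}

/-- An `F`-automorphism of `E = F + F s` with `c s = −s` is an involution. -/
theorem trans_self_eq_refl_of_apply_s_eq_neg (hspan : Submodule.span F {(1 : E), s} = ⊤)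
    (c : E ≃ₐ[F] E) (hc : c s = -s) : c.trans c = AlgEquiv.refl := by
  refine AlgEquiv.ext fun x => ?_
  have hx : x ∈ Submodule.span F {(1 : E), s} := hspan ▸ Submodule.mem_top
  obtain ⟨a, b, rfl⟩ := Submodule.mem_span_pair.mp hx
  simp only [AlgEquiv.trans_apply, map_add, map_smul, map_one, hc, map_neg, neg_neg, AlgEquiv.coe_refl, id_eq]

end Involution

section Star

variable {F E : Type*} [Field F] [NumberField F] [Field E] [NumberField E] [Algebra F E]
  [Algebra.IsQuadraticExtension F E]
variable (v : HeightOneSpectrum (𝓞 F)) (w : HeightOneSpectrum (𝓞 E)) [w.asIdeal.LiesOver v.asIdeal]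
variable {s : E} {θ : F}
variable (hs : s ^ 2 = algebraMap F E θ) (hspan : Submodule.span F {(1 : E), s} = ⊤)
  (hsq : ¬ IsSquare (algebraMap F (v.adicCompletion F) θ)) (c : E ≃ₐ[F] E) (hc : c s = -s)

/-- **`E_w` as a star-ring** at a non-split place: `star` = the local conjugation `extendAut c`. A definition,
not an instance. -/
noncomputable abbrev localStarRing : StarRing (w.adicCompletion E) where
  star := extendAutOfNotIsSquare v w hs hspan hsq c
  star_involutive := extendAutOfNotIsSquare_extendAutOfNotIsSquare v w hs hspan hsq c
    (trans_self_eq_refl_of_apply_s_eq_neg hspan c hc)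
  star_mul x y := by rw [map_mul, mul_comm]
  star_add x y := map_add _ x y

/-- `star` is the local conjugation. -/
theorem star_def (y : w.adicCompletion E) :
    letI := localStarRing v w hs hspan hsq c hc
    star y = extendAutOfNotIsSquare v w hs hspan hsq c y := rfl

/-- `star` acts as `c` on the image of `E`. -/
theorem star_algebraMap (x : E) :
    letI := localStarRing v w hs hspan hsq c hc
    star (algebraMap E (w.adicCompletion E) x) = algebraMap E (w.adicCompletion E) (c x) :=
  extendAutOfNotIsSquare_algebraMap v w hs hspan hsq c x

/-- `star` fixes `F_v`. -/
theorem star_algebraMap_left (a : v.adicCompletion F) :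
    letI := localStarRing v w hs hspan hsq c hc
    star (algebraMap (v.adicCompletion F) (w.adicCompletion E) a) =
      algebraMap (v.adicCompletion F) (w.adicCompletion E) a :=
  AlgEquiv.commutes _ a

/-- Elements of `F_v` are self-adjoint. -/
theorem isSelfAdjoint_algebraMap_left (a : v.adicCompletion F) :
    letI := localStarRing v w hs hspan hsq c hc
    IsSelfAdjoint (algebraMap (v.adicCompletion F) (w.adicCompletion E) a) :=
  star_algebraMap_left v w hs hspan hsq c hc a

/-- `star √θ = −√θ`. -/
theorem star_algebraMap_s :
    letI := localStarRing v w hs hspan hsq c hc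
    star (algebraMap E (w.adicCompletion E) s) = -(algebraMap E (w.adicCompletion E) s) :=
  extendAutOfNotIsSquare_apply_s v w hs hspan hsq c hc

/-- **`y · star y = N_{E_w/F_v}(y)`** (in `E_w`). -/
theorem mul_star_eq_norm (y : w.adicCompletion E) :
    letI := localStarRing v w hs hspan hsq c hc
    y * star y = algebraMap (v.adicCompletion F) (w.adicCompletion E) (Algebra.norm (v.adicCompletion F) y) :=
  (algebraMap_norm_eq_mul_localConj v w hs hspan hsq c hc y).symm

open Classical in
/-- **`y + star y = tr_{E_w/F_v}(y)`** (in `E_w`). -/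
theorem add_star_eq_trace (y : w.adicCompletion E) :
    letI := localStarRing v w hs hspan hsq c hc
    y + star y = algebraMap (v.adicCompletion F) (w.adicCompletion E)
      (Algebra.trace (v.adicCompletion F) (w.adicCompletion E) y) := by
  haveI := isGalois v w hs hspan hsq c hc
  rw [trace_eq_sum_automorphisms, univ_eq_pair v w hs hspan hsq c hc,
    Finset.sum_pair (extendAutOfNotIsSquare_ne_refl v w hs hspan hsq c hc).symm, AlgEquiv.coe_refl, id_eq]
  rfl

/-- **The fixed field of the local conjugation is `F_v`:** `star y = y ↔ y ∈ F_v`. -/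
theorem star_eq_self_iff (y : w.adicCompletion E) :
    letI := localStarRing v w hs hspan hsq c hc
    star y = y ↔ y ∈ (algebraMap (v.adicCompletion F) (w.adicCompletion E)).range := by
  letI := localStarRing v w hs hspan hsq c hc
  constructor
  · intro hy
    haveI : CharZero (w.adicCompletion E) :=
      charZero_of_injective_algebraMap (algebraMap ℚ (w.adicCompletion E)).injective
    have htr := add_star_eq_trace v w hs hspan hsq c hc y
    rw [hy] at htr
    refine ⟨Algebra.trace (v.adicCompletion F) (w.adicCompletion E) y / 2, ?_⟩
    rw [map_div₀, ← htr, map_ofNat, ← two_mul, mul_div_cancel_left₀ y two_ne_zero]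
  · rintro ⟨a, rfl⟩
    exact star_algebraMap_left v w hs hspan hsq c hc a

/-- `IsSelfAdjoint y ↔ y ∈ F_v`. -/
theorem isSelfAdjoint_iff (y : w.adicCompletion E) :
    letI := localStarRing v w hs hspan hsq c hc
    IsSelfAdjoint y ↔ y ∈ (algebraMap (v.adicCompletion F) (w.adicCompletion E)).range :=
  star_eq_self_iff v w hs hspan hsq c hc y

end Star

end Summit.Ventures.HodgeRepro2.T5FinitePlaceStar
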